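import Summits.QuantumFields.YangMills.Theorems.BalabanLadderInfVolPlaneDictionary
import Summits.QuantumFields.YangMills.Theorems.LangevinControlUVOSLegsFromFemtoAndGapStubAssemblyNontrivial
import HarnessLib

/-!
# Non-triviality and non-Gaussianity of an infinite-volume continuum limit from the volume-free floors

HONEST FRAMING (R136 (i) «parallel continuum programme», seat `ym-infvol-p1`; the NT∕NG half of the route's support
`IVData` per the planner's DESIGN 2026-08-26T17:44:53Z and seat p2's split; bears on the spine route `BalabanLadder`,
leaf `UV` = stmt-QuantumFields-19351, cruxes `NT` 19353 / `UVSeamRec` 20043 whose conclusions carry `LowerBounds`).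
Binder-agnostic soft analysis, kernel-checked — the infinite-volume twin of toolkit XI-b
(`OSLegsFromFemtoAndGap.twoPointNontrivial_of_lowerBounds` / `nonGaussian_of_lowerBounds`, which run along TORUS
schemes).  The floors (`LowerBoundsOn … (oddTorusLimitPoints r)` = `LowerBoundsTL`, obtained from `LowerBounds` by
`lowerBoundsTL_of_lowerBounds`) and the convergence of the smeared infinite-volume correlation sums to the candidate
continuum functional `S₁` are HYPOTHESES; nothing about Yang–Mills is asserted.  Existence half only; not a gap, not Clay.

* §1 **`twoPointNontrivial_of_lowerBoundsTL`** — along couplings `β_k → ∞` and states `μ_k ∈ oddTorusLimitPoints r (β_k)`,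
  if `S₁ 1 = 0` (canonical centring) and `(Q2State G r μ_k (a β_k) u v : ℂ) → S₁ 2 (u ⊗ v)` for real `u` (negative times),
  `v` (positive times), then the volume-free floor (i) gives the spine-shape non-triviality clause of `S₁.toLabelled`
  (tree `HypercubicLimit.Negative.twoPointNontrivial_of_real` with `u = θv`).
* §2 **`nonGaussian_of_lowerBoundsTL`** — likewise the floor (ii) and `(Q3State … f g h : ℂ) → S₁ 3 (f ⊗ g ⊗ h)` (pairwise
  disjoint supports) give the spine-shape non-Gaussianity clause (with `S₁ 1 = 0` the cumulant combination is
  `S₁ 3 (f ⊗ g ⊗ h)`; `f ⊗ g ⊗ h ∈ ⁰𝒮` by `isOffDiagonal_of_disjoint_three`).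
* §3 **the complexified dictionary in string indexing** — `ofReal_q2State_eq_sum_tsum_tensor₂`,
  `ofReal_q3State_eq_sum_tsum` : `(Q2State μ s u v : ℂ) = Σ_{Q : Fin 2 → valid} Σ'_{x : Fin 2 → ℤ⁴}
  (stateMomentStr μ 2 Q x : ℂ) · (u ⊗ v)(l ↦ s·x_l)` and the `n = 3` analogue for any tensor `T₃` of `f, g, h` — i.e. the
  Q2∕Q3 sums ARE the orientation sums of the BASE-POINT (`o = 0`) plane-string series of the route's DATA clause evaluated
  at tensor test functions; the route's plaquette-CENTRE offsets differ from base points by `a·o`, `‖o‖ ≤ 1`, an `O(a)`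
  shift handled by the shift-defect bound of seat p2's junction file (so `nt_ng_of_ivData` = §1–§2 ∘ shift defect ∘ §3).

References: K. Osterwalder, E. Seiler, Ann. Phys. 110 (1978) §2; K. Osterwalder, R. Schrader, CMP 31 (1973) §2 (`⁰𝒮`, E0);
A. Jaffe, E. Witten (2006) §5–§6.
-/

set_option autoImplicit false

noncomputable section

open MeasureTheory Filter Topology
open scoped BigOperators SchwartzMap
open Literature.MathematicalPhysics.QuantumFieldTheory hiding ZdEdge
open Literature.MathematicalPhysics.QuantumLattice
open Literature.MathematicalPhysics.AQFT
open Literature.Probability.LatticeModels (Site)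
open Summit.QuantumFields.YangMills.Cruxes.OSLegsFromFemtoAndGap.DlrCollarTransfer
open Summit.QuantumFields.YangMills.Theorems.HypercubicLimit.Negative
  (tensor₁ tensor₂ thetaTensor₁ tensor₂_apply isTensorOf_tensor₂ twoPointNontrivial_of_real
    isOffDiagonal_of_halfSpaces tsupport_thetaTest_neg)
open Summit.QuantumFields.YangMills.Theorems.OSLegsFromFemtoAndGap (isOffDiagonal_of_disjoint_three)

namespace Summit.QuantumFields.YangMills.Theorems.InfiniteVolume

variable {G : Type} [Group G] [TopologicalSpace G] [IsTopologicalGroup G] [CompactSpace G]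
  [MeasurableSpace G] [BorelSpace G]

/-! ## §1 Non-triviality -/

/-- **Non-triviality of an infinite-volume continuum limit from the volume-free floor (i).**  Couplings `β_k → ∞`,
states `μ_k ∈ oddTorusLimitPoints r (β_k)`, a one-field family `S₁` with `S₁ 1 = 0` to which the complexified smeared
truncated two-point sums `Q2State G r μ_k (a β_k) u v` converge at every real pair `u` (negative times), `v` (positive
times); then the floor `ε ≤ Q2State μ (a β) (θv) v` (all `β ≥ β₅`, all odd-torus limit states) gives the spine-shape
non-triviality clause for `S₁.toLabelled` (`F₁ = θv ∘ θ`-tensor, `G₁ = v`, `H₁ = θv ⊗ v`). [folklore] -/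
theorem twoPointNontrivial_of_lowerBoundsTL (r : LatticeRep G) {a : ℝ → ℝ}
    (hLB : ∃ (v : 𝓢(EuclideanSpace ℝ (Fin 4), ℝ)) (ε β₅ : ℝ),
      tsupport v ⊆ {y : EuclideanSpace ℝ (Fin 4) | 0 < y 0} ∧ 0 < ε ∧
        ∀ β : ℝ, β₅ ≤ β → ∀ μ ∈ oddTorusLimitPoints r β, ε ≤ Q2State G r μ (a β) (thetaTest 4 v) v)
    (βs : ℕ → ℝ) (hβ : Tendsto βs atTop atTop) (μ : ℕ → Measure (LGConfig 4 G))
    (hμ : ∀ k, μ k ∈ oddTorusLimitPoints r (βs k)) (S₁ : SchwingerFamily (EuclideanSpace ℝ (Fin 4)))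
    (h1 : ∀ F : 𝓢((Fin 1 → EuclideanSpace ℝ (Fin 4)), ℂ), S₁ 1 F = 0)
    (hconv : ∀ u v : 𝓢(EuclideanSpace ℝ (Fin 4), ℝ), tsupport u ⊆ {y : EuclideanSpace ℝ (Fin 4) | y 0 < 0} →
      tsupport v ⊆ {y : EuclideanSpace ℝ (Fin 4) | 0 < y 0} →
        Tendsto (fun k => ((Q2State G r (μ k) (a (βs k)) u v : ℝ) : ℂ)) atTop (𝓝 (S₁ 2 (tensor₂ u v)))) :
    ∃ (F₁ G₁ : 𝓢((Fin 1 → EuclideanSpace ℝ (Fin 4)), ℂ)) (H₁ : 𝓢((Fin (1 + 1) → EuclideanSpace ℝ (Fin 4)), ℂ)),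
      IsTimeOrdered F₁ ∧ IsTimeOrdered G₁ ∧ IsAppendTensorOf H₁ (osAdjoint F₁) G₁ ∧
        S₁.toLabelled (1 + 1) (fun _ => ()) H₁ ≠
          S₁.toLabelled 1 (fun _ => ()) (osAdjoint F₁) * S₁.toLabelled 1 (fun _ => ()) G₁ := by
  obtain ⟨v, ε, β₅, hv, hε, hQ⟩ := hLB
  have hu := tsupport_thetaTest_neg hv
  refine twoPointNontrivial_of_real S₁.toLabelled () hu hv ?_
  simp only [SchwingerFamily.toLabelled_apply, h1, mul_zero]
  have hlim := hconv (thetaTest 4 v) v hu hv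
  have hev : ∀ᶠ k in atTop, ε ≤ Q2State G r (μ k) (a (βs k)) (thetaTest 4 v) v := by
    filter_upwards [hβ.eventually_ge_atTop β₅] with k hk
    exact hQ _ hk _ (hμ k)
  have hre : Tendsto (fun k => (((Q2State G r (μ k) (a (βs k)) (thetaTest 4 v) v : ℝ) : ℂ)).re) atTop
      (𝓝 (S₁ 2 (tensor₂ (thetaTest 4 v) v)).re) := (Complex.continuous_re.tendsto _).comp hlim
  have hge : ε ≤ (S₁ 2 (tensor₂ (thetaTest 4 v) v)).re :=
    ge_of_tendsto hre (hev.mono fun k hk => by rw [Complex.ofReal_re]; exact hk)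
  intro h0
  have : (S₁ 2 (tensor₂ (thetaTest 4 v) v)).re = 0 := by
    rw [show S₁ 2 (tensor₂ (thetaTest 4 v) v) = 0 from h0, Complex.zero_re]
  linarith

/-! ## §2 Non-Gaussianity -/

/-- **Non-Gaussianity of an infinite-volume continuum limit from the volume-free floor (ii).**  With `S₁ 1 = 0` and the
complexified smeared connected three-point sums `Q3State G r μ_k (a β_k) f g h` converging to `S₁ 3 T₃` for every tensor
`T₃` of real `f, g, h` with pairwise disjoint supports, the floor `ε ≤ |Q3State μ (a β) f g h|` gives the spine-shape
non-Gaussianity clause (the eight tensors are `tensorFin`s; the cumulant combination collapses to `S₁ 3 (f ⊗ g ⊗ h)`).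
[folklore] -/
theorem nonGaussian_of_lowerBoundsTL (r : LatticeRep G) {a : ℝ → ℝ}
    (hLB : ∃ (f g h : 𝓢(EuclideanSpace ℝ (Fin 4), ℝ)) (ε β₅ : ℝ), Disjoint (tsupport f) (tsupport g) ∧
      Disjoint (tsupport g) (tsupport h) ∧ Disjoint (tsupport f) (tsupport h) ∧ 0 < ε ∧
      ∀ β : ℝ, β₅ ≤ β → ∀ μ ∈ oddTorusLimitPoints r β, ε ≤ |Q3State G r μ (a β) f g h|)
    (βs : ℕ → ℝ) (hβ : Tendsto βs atTop atTop) (μ : ℕ → Measure (LGConfig 4 G))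
    (hμ : ∀ k, μ k ∈ oddTorusLimitPoints r (βs k)) (S₁ : SchwingerFamily (EuclideanSpace ℝ (Fin 4)))
    (h1 : ∀ F : 𝓢((Fin 1 → EuclideanSpace ℝ (Fin 4)), ℂ), S₁ 1 F = 0)
    (hconv : ∀ (f g h : 𝓢(EuclideanSpace ℝ (Fin 4), ℝ)) (T₃ : 𝓢((Fin 3 → EuclideanSpace ℝ (Fin 4)), ℂ)),
      Disjoint (tsupport f) (tsupport g) → Disjoint (tsupport g) (tsupport h) → Disjoint (tsupport f) (tsupport h) →
      IsTensorOf T₃ ![ofRealTest f, ofRealTest g, ofRealTest h] →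
        Tendsto (fun k => ((Q3State G r (μ k) (a (βs k)) f g h : ℝ) : ℂ)) atTop (𝓝 (S₁ 3 T₃))) :
    ∃ (f g h : 𝓢(EuclideanSpace ℝ (Fin 4), ℂ)) (Ffgh : 𝓢((Fin 3 → EuclideanSpace ℝ (Fin 4)), ℂ))
      (Fgh Ffh Ffg : 𝓢((Fin 2 → EuclideanSpace ℝ (Fin 4)), ℂ)) (Ff Fg Fh : 𝓢((Fin 1 → EuclideanSpace ℝ (Fin 4)), ℂ)),
      IsTensorOf Ffgh ![f, g, h] ∧ IsOffDiagonal Ffgh ∧ IsTensorOf Fgh ![g, h] ∧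
      IsTensorOf Ffh ![f, h] ∧ IsTensorOf Ffg ![f, g] ∧ IsTensorOf Ff ![f] ∧ IsTensorOf Fg ![g] ∧
      IsTensorOf Fh ![h] ∧
        S₁.toLabelled 3 (fun _ => ()) Ffgh - S₁.toLabelled 1 (fun _ => ()) Ff * S₁.toLabelled 2 (fun _ => ()) Fgh -
          S₁.toLabelled 1 (fun _ => ()) Fg * S₁.toLabelled 2 (fun _ => ()) Ffh -
          S₁.toLabelled 1 (fun _ => ()) Fh * S₁.toLabelled 2 (fun _ => ()) Ffg +
          2 * (S₁.toLabelled 1 (fun _ => ()) Ff * S₁.toLabelled 1 (fun _ => ()) Fg *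
            S₁.toLabelled 1 (fun _ => ()) Fh) ≠ 0 := by
  obtain ⟨f, g, h, ε, β₅, hfg, hgh, hfh, hε, hQ⟩ := hLB
  set T3 : 𝓢((Fin 3 → EuclideanSpace ℝ (Fin 4)), ℂ) :=
    SchwartzMap.tensorFin 3 ![ofRealTest f, ofRealTest g, ofRealTest h]
  have hT3 : IsTensorOf T3 ![ofRealTest f, ofRealTest g, ofRealTest h] := isTensorOf_tensorFin _
  have hod : IsOffDiagonal T3 := isOffDiagonal_of_disjoint_three hfg hgh hfh hT3
  refine ⟨ofRealTest f, ofRealTest g, ofRealTest h, T3,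
    SchwartzMap.tensorFin 2 ![ofRealTest g, ofRealTest h], SchwartzMap.tensorFin 2 ![ofRealTest f, ofRealTest h],
    SchwartzMap.tensorFin 2 ![ofRealTest f, ofRealTest g], SchwartzMap.tensorFin 1 ![ofRealTest f],
    SchwartzMap.tensorFin 1 ![ofRealTest g], SchwartzMap.tensorFin 1 ![ofRealTest h], hT3, hod,
    isTensorOf_tensorFin _, isTensorOf_tensorFin _, isTensorOf_tensorFin _, isTensorOf_tensorFin _,
    isTensorOf_tensorFin _, isTensorOf_tensorFin _, ?_⟩
  simp only [SchwingerFamily.toLabelled_apply, h1, zero_mul, sub_zero, mul_zero, add_zero]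
  have hlim := hconv f g h T3 hfg hgh hfh hT3
  have hev : ∀ᶠ k in atTop, ε ≤ |Q3State G r (μ k) (a (βs k)) f g h| := by
    filter_upwards [hβ.eventually_ge_atTop β₅] with k hk
    exact hQ _ hk _ (hμ k)
  have hnorm : Tendsto (fun k => ‖((Q3State G r (μ k) (a (βs k)) f g h : ℝ) : ℂ)‖) atTop (𝓝 ‖S₁ 3 T3‖) :=
    (continuous_norm.tendsto _).comp hlim
  have hge : ε ≤ ‖S₁ 3 T3‖ :=
    ge_of_tendsto hnorm (hev.mono fun k hk => by rw [Complex.norm_real, Real.norm_eq_abs]; exact hk)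
  intro h0
  rw [h0, norm_zero] at hge
  linarith

/-! ## §3 The complexified dictionary in string indexing (`Fin n → ℤ⁴`, tensor test functions, base points) -/

section Dictionary

variable (r : LatticeRep G) (μ : Measure (LGConfig 4 G)) [IsProbabilityMeasure μ]

/-- **`Q2State` (complexified) is the orientation sum of the base-point `n = 2` plane-string series evaluated at the
tensor `u ⊗ v`**: `(Q2State μ s u v : ℂ) = Σ_{Q} Σ'_{x : Fin 2 → ℤ⁴} (stateMomentStr μ 2 Q x : ℂ) · (u ⊗ v)(l ↦ s·x_l)`
(`s > 0`). [folklore] -/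
theorem ofReal_q2State_eq_sum_tsum_tensor₂ {s : ℝ} (hs : 0 < s) (u v : 𝓢(EuclideanSpace ℝ (Fin 4), ℝ)) :
    ((Q2State G r μ s u v : ℝ) : ℂ) =
      ∑ Q ∈ Fintype.piFinset (fun _ : Fin 2 => Finset.univ.filter (fun q : Fin 4 × Fin 4 => q.1 < q.2)),
        ∑' x : Fin 2 → Site 4, ((stateMomentStr G r μ 2 Q x : ℝ) : ℂ) *
          tensor₂ u v (fun l => s • siteToE (x l)) := by
  -- pairs as strings of length two
  let e : Site 4 × Site 4 ≃ (Fin 2 → Site 4) :=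
    { toFun := fun p => ![p.1, p.2]
      invFun := fun x => (x 0, x 1)
      left_inv := fun p => by simp
      right_inv := fun x => by funext i; fin_cases i <;> rfl }
  rw [q2State_eq_sum_series r μ hs u v, Complex.ofReal_sum]
  refine Finset.sum_congr rfl fun Q _ => ?_
  rw [Complex.ofReal_tsum, ← Equiv.tsum_eq e.symm]
  refine tsum_congr fun x => ?_
  have hx : (![x 0, x 1] : Fin 2 → Site 4) = x := by funext i; fin_cases i <;> rfl
  simp only [e, Equiv.coe_fn_symm_mk, tensor₂_apply, hx]
  push_cast
  ring

/-- **`Q3State` (complexified) is the orientation sum of the base-point `n = 3` plane-string series evaluated at any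
tensor `T₃` of `f, g, h`** (`s > 0`). [folklore] -/
theorem ofReal_q3State_eq_sum_tsum {s : ℝ} (hs : 0 < s) (f g h : 𝓢(EuclideanSpace ℝ (Fin 4), ℝ))
    (T₃ : 𝓢((Fin 3 → EuclideanSpace ℝ (Fin 4)), ℂ)) (hT : IsTensorOf T₃ ![ofRealTest f, ofRealTest g, ofRealTest h]) :
    ((Q3State G r μ s f g h : ℝ) : ℂ) =
      ∑ Q ∈ Fintype.piFinset (fun _ : Fin 3 => Finset.univ.filter (fun q : Fin 4 × Fin 4 => q.1 < q.2)),
        ∑' x : Fin 3 → Site 4, ((stateMomentStr G r μ 3 Q x : ℝ) : ℂ) * T₃ (fun l => s • siteToE (x l)) := by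
  -- triples as strings of length three
  let e : Site 4 × Site 4 × Site 4 ≃ (Fin 3 → Site 4) :=
    { toFun := fun p => ![p.1, p.2.1, p.2.2]
      invFun := fun x => (x 0, x 1, x 2)
      left_inv := fun p => by simp
      right_inv := fun x => by funext i; fin_cases i <;> rfl }
  rw [q3State_eq_sum_series r μ hs f g h, Complex.ofReal_sum]
  refine Finset.sum_congr rfl fun Q _ => ?_
  rw [Complex.ofReal_tsum, ← Equiv.tsum_eq e.symm]
  refine tsum_congr fun x => ?_
  have hx : (![x 0, x 1, x 2] : Fin 3 → Site 4) = x := by funext i; fin_cases i <;> rfl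
  rw [hT]
  simp only [e, Equiv.coe_fn_symm_mk, Fin.prod_univ_three, Matrix.cons_val_zero, Matrix.cons_val_one,
    Matrix.cons_val, ofRealTest_apply, hx]
  push_cast
  ring

end Dictionary

end Summit.QuantumFields.YangMills.Theorems.InfiniteVolume

end
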